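/-
Copyright: the b2b-balaban T⁴-continuum CRUX team, row NE7b OWNER lineage `t4-ne7b-p1` (gen 119). Project licence.
-/
import Summits.QuantumFields.BalabanUV.T4Continuum.Spine.NE7b.SupConvexStepLaplace

/-!
# FOR A QUADRATIC ACTION THE INTEGRATED AND THE MINIMISED BLOCK-SPIN STEPS COINCIDE UP TO A FIELD-INDEPENDENT CONSTANT: if `S` has
# an EXACT second-order letter `S ψ = S φ + S′φ(ψ − φ) + ½H(ψ − φ)(ψ − φ)` with a fixed form `H` (floor `m > 0`), then along ANY chart
# `P` onto `ker Qt` and for the fibre-critical `Φ` of (110), `∫ e^{−S(M w + P z)} dz = e^{−S(Φ w)} · ∫ e^{−½H(P z)(P z)} dz` at EVERY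
# `w` — so `W_int = W_min − log C` with ONE constant `C`: (117)'s sandwich closes, the background field carries ALL the `w`-dependence
# and the fluctuation integral NONE — the structural reason print's free-field steps are computed by minimisation
# (row NE7b, node U5c; (115) + (117) BY NAME; [folklore])

Cell `pub-balaban`, sub-cell `t4`, spine estimate NE7b (`T4WeightBudget.RelWeightBound`; the cell's OWN estimate — NOT PRINTED in
[Bałaban 1983–89], NOT PROVED).  Crux-route work under `Spine/NE7b/` by the row OWNER (`t4-ne7b-p1` gen 119) under FREEZE (0)'s
crux-prover clause (the exact case of (117)'s Laplace sandwich); NOTHING of Bałaban's is named as a Lean object, valued or asserted; no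
`T4Continuum/Support` leaf typed; no `def`, no notation; zero `sorry`.  Imports (BY NAME): the OWNER's (117) `…SupConvexStepLaplace`
(`integrable_gaussian_pi_shift`; through it (115) `integrable_gaussian_pi`, `fibreIntegral_pos`, (114) `continuous_of_hasFDerivAt`),
Mathlib's translation invariance of the product Lebesgue measure.

WHY (located).  (117) sandwiches `W_int − W_min` in a window of width `½|σ|·log(Λp′∕(mp))`; for the free (Gaussian) steps of print
the window must CLOSE, since there the effective action is computed exactly by the background field.  On the class this is the
exact second-order letter: at the fibre-critical `Φ w` the linear term dies on `ker Qt ∋ M w + P z − Φ w = P(z + z₀)`, so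
`S(M w + P z) = S(Φ w) + ½H(P(z + z₀))(P(z + z₀))` and translation invariance of `dz` removes `z₀(w)`: the fluctuation integral is the
SAME Gaussian integral at every `w`.

WHAT IS PROVED ([folklore]; finite carriers `ι, κ, σ`; `H : ℝ^ι →L ℝ^ι →L ℝ` with floor `m·Σ h² ≤ H h h`, `m > 0`; chart `p·Σ z² ≤ Σ(P z)²`,
`p > 0`, `P` onto `ker Qt`; `Qt∘M = 1`, `Qt∘P = 0`; `Φ` fibre-critical with `Qt(Φ w) = w`):
* §1 `exact_letter_on_fibre` (`S(M w + P z) = S(Φ w) + ½H(P(z + z₀))(P(z + z₀))` for the `z₀` with `P z₀ = M w − Φ w`),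
  `integrable_exp_neg_form_chart` (`z ↦ e^{−½H(P z)(P z)}` is integrable), `formIntegral_pos`.
* §2 **`fibreIntegral_eq_gaussian`** (THE IDENTITY `∫ e^{−S(M w + P z)} dz = e^{−S(Φ w)}·∫ e^{−½H(P z)(P z)} dz` at every `w`),
  **`negLog_fibreIntegral_eq`** (`W_int(w) = S(Φ w) − log ∫ e^{−½H(P z)(P z)} dz`), **`increment_eq`** (`W_int w′ − W_int w =
  S(Φ w′) − S(Φ w)` — the integrated and the minimised effective actions have IDENTICAL increments).
* §3 toy.

HONEST (what this is NOT).  The Gaussian case only (exact second-order letter = quadratic action); no evaluation of the constant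
(a determinant — not needed for increments); no locality; nothing about which block maps ∕ charts print uses; cubic periods; scalar
skeleton, hard constraint ((A3), NC-NE7b-α UNRULED); nothing of Bałaban's.  BY-NAME EFFECT ON THE WALL: NONE.  NE7b NOT PRINTED ∕ NOT
PROVED; spine PROVED 0∕9; rung (B)+1 on a FINITE torus — NOT infinite volume, NOT the mass gap, NOT Clay.  HONEST DEPENDENCY: continuum YM
on T⁴ ⇐ BetaPertH ∧ nine spine estimates (0∕9 proved); BetaPertH ⇐ (D1) ∧ (D4) ∧ CAP+tail; G-an2-4 gates asym, D1 and NE2∕3∕4.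
-/

set_option autoImplicit false

noncomputable section

namespace Summit.QuantumFields.BalabanUV.T4Continuum.NE7b.SupConvexStepGaussianExact

open Set Function Filter MeasureTheory Real
open scoped Topology
open SupConvexFibreIntegral (integrable_gaussian_pi)

variable {ι κ σ : Type*} [Fintype ι] [Fintype κ] [Fintype σ]
  {S : (ι → ℝ) → ℝ} {S' : (ι → ℝ) → (ι → ℝ) →L[ℝ] ℝ} {H : (ι → ℝ) →L[ℝ] (ι → ℝ) →L[ℝ] ℝ} {m p : ℝ}
  (Qt : (ι → ℝ) →L[ℝ] (κ → ℝ)) (M : (κ → ℝ) →L[ℝ] (ι → ℝ)) (P : (σ → ℝ) →L[ℝ] (ι → ℝ))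

/-! ## §1. The exact letter on the fibre; the Gaussian fluctuation density -/

omit [Fintype ι] [Fintype κ] [Fintype σ] in
/-- **THE EXACT LETTER ON THE FIBRE**: with the exact second-order letter, `Φ` fibre-critical (`S′(Φ w)` kills `ker Qt`), `Qt∘P = 0`
and `P z₀ = M w − Φ w`: `S(M w + P z) = S(Φ w) + ½H(P(z + z₀))(P(z + z₀))` for every `z`. [folklore] -/
theorem exact_letter_on_fibre
    (hquad : ∀ φ ψ : ι → ℝ, S ψ = S φ + S' φ (ψ - φ) + (1 / 2 : ℝ) * H (ψ - φ) (ψ - φ))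
    (hQP : ∀ z : σ → ℝ, Qt (P z) = 0)
    {Φ : (κ → ℝ) → (ι → ℝ)} (hΦcrit : ∀ (w : κ → ℝ) (h : ι → ℝ), Qt h = 0 → S' (Φ w) h = 0)
    (w : κ → ℝ) {z₀ : σ → ℝ} (hz₀ : P z₀ = M w - Φ w) (z : σ → ℝ) :
    S (M w + P z) = S (Φ w) + (1 / 2 : ℝ) * H (P (z + z₀)) (P (z + z₀)) := by
  have e : M w + P z - Φ w = P (z + z₀) := by rw [map_add, hz₀]; abel
  have hkill : S' (Φ w) (M w + P z - Φ w) = 0 := hΦcrit w _ (by rw [e, hQP])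
  rw [hquad (Φ w) (M w + P z), hkill, add_zero, e]

omit [Fintype κ] in
/-- **THE GAUSSIAN FLUCTUATION DENSITY IS INTEGRABLE** (floor `m > 0`, chart `p > 0`): `z ↦ e^{−½H(P(z + c))(P(z + c))}` is
integrable on `σ → ℝ` for every shift `c`. [folklore] -/
theorem integrable_exp_neg_form_chart (hfl : ∀ h : ι → ℝ, m * ∑ x, h x ^ 2 ≤ H h h) (hm : 0 < m)
    (hP : ∀ z : σ → ℝ, p * ∑ i, z i ^ 2 ≤ ∑ x, P z x ^ 2) (hp : 0 < p) (c : σ → ℝ) :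
    Integrable (fun z : σ → ℝ => exp (-((1 / 2 : ℝ) * H (P (z + c)) (P (z + c))))) := by
  have hcont : Continuous fun z : σ → ℝ => exp (-((1 / 2 : ℝ) * H (P (z + c)) (P (z + c)))) := by
    have hPc : Continuous fun z : σ → ℝ => P (z + c) := P.continuous.comp (continuous_id.add continuous_const)
    exact continuous_exp.comp ((continuous_const.mul ((H.continuous₂).comp (hPc.prodMk hPc))).neg)
  have hg := (integrable_gaussian_pi (σ := σ) (a := m * p / 2) (by positivity) 1).comp_sub_right (-c)
  refine Integrable.mono' hg hcont.aestronglyMeasurable (Eventually.of_forall fun z => ?_)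
  rw [Real.norm_eq_abs, abs_of_pos (exp_pos _), one_mul]
  refine exp_le_exp.2 ?_
  have h1 := hfl (P (z + c))
  have h2 := hP (z + c)
  have e : ∑ i, (z - -c) i ^ 2 = ∑ i, (z + c) i ^ 2 :=
    Finset.sum_congr rfl fun i _ => by simp only [Pi.sub_apply, Pi.neg_apply, Pi.add_apply, sub_neg_eq_add]
  rw [e]
  nlinarith

omit [Fintype κ] in
/-- The Gaussian fluctuation integral is positive. [folklore] -/
theorem formIntegral_pos (hfl : ∀ h : ι → ℝ, m * ∑ x, h x ^ 2 ≤ H h h) (hm : 0 < m)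
    (hP : ∀ z : σ → ℝ, p * ∑ i, z i ^ 2 ≤ ∑ x, P z x ^ 2) (hp : 0 < p) :
    0 < ∫ z : σ → ℝ, exp (-((1 / 2 : ℝ) * H (P z) (P z))) := by
  have h := integrable_exp_neg_form_chart P hfl hm hP hp 0
  simp only [add_zero] at h
  exact integral_exp_pos h

/-! ## §2. The identity -/

omit [Fintype ι] [Fintype κ] in
/-- **THE FIBRE INTEGRAL OF A QUADRATIC ACTION IS THE BACKGROUND FACTOR TIMES ONE GAUSSIAN CONSTANT**: exact second-order letter,
chart `P` ONTO `ker Qt`, `Qt∘M = 1`, `Qt∘P = 0`, `Φ` fibre-critical with `Qt(Φ w) = w` ⟹ at EVERY `w`,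
`∫ e^{−S(M w + P z)} dz = e^{−S(Φ w)} · ∫ e^{−½H(P z)(P z)} dz` (no integrability needed: both sides are the same junk otherwise).
[folklore] -/
theorem fibreIntegral_eq_gaussian
    (hquad : ∀ φ ψ : ι → ℝ, S ψ = S φ + S' φ (ψ - φ) + (1 / 2 : ℝ) * H (ψ - φ) (ψ - φ))
    (hQM : ∀ k : κ → ℝ, Qt (M k) = k) (hQP : ∀ z : σ → ℝ, Qt (P z) = 0)
    (hPsurj : ∀ h : ι → ℝ, Qt h = 0 → ∃ z : σ → ℝ, P z = h)
    {Φ : (κ → ℝ) → (ι → ℝ)} (hΦQ : ∀ w, Qt (Φ w) = w) (hΦcrit : ∀ (w : κ → ℝ) (h : ι → ℝ), Qt h = 0 → S' (Φ w) h = 0)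
    (w : κ → ℝ) :
    ∫ z : σ → ℝ, exp (-S (M w + P z)) = exp (-S (Φ w)) * ∫ z : σ → ℝ, exp (-((1 / 2 : ℝ) * H (P z) (P z))) := by
  obtain ⟨z₀, hz₀⟩ := hPsurj (M w - Φ w) (by rw [map_sub, hQM, hΦQ, sub_self])
  have hpt : ∀ z : σ → ℝ, exp (-S (M w + P z)) = exp (-S (Φ w)) * exp (-((1 / 2 : ℝ) * H (P (z + z₀)) (P (z + z₀)))) := by
    intro z
    rw [exact_letter_on_fibre Qt M P hquad hQP hΦcrit w hz₀ z, ← exp_add]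
    congr 1; ring
  simp_rw [hpt]
  rw [integral_const_mul]
  congr 1
  have := integral_add_right_eq_self (μ := (volume : Measure (σ → ℝ)))
    (fun z : σ → ℝ => exp (-((1 / 2 : ℝ) * H (P z) (P z)))) z₀
  exact this

omit [Fintype κ] in
/-- **THE INTEGRATED EFFECTIVE ACTION OF A QUADRATIC ACTION IS THE MINIMISED ONE, SHIFTED BY A CONSTANT**:
`−log ∫ e^{−S(M w + P z)} dz = S(Φ w) − log ∫ e^{−½H(P z)(P z)} dz` at every `w`. [folklore] -/
theorem negLog_fibreIntegral_eq
    (hquad : ∀ φ ψ : ι → ℝ, S ψ = S φ + S' φ (ψ - φ) + (1 / 2 : ℝ) * H (ψ - φ) (ψ - φ))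
    (hfl : ∀ h : ι → ℝ, m * ∑ x, h x ^ 2 ≤ H h h) (hm : 0 < m)
    (hQM : ∀ k : κ → ℝ, Qt (M k) = k) (hQP : ∀ z : σ → ℝ, Qt (P z) = 0)
    (hP : ∀ z : σ → ℝ, p * ∑ i, z i ^ 2 ≤ ∑ x, P z x ^ 2) (hp : 0 < p)
    (hPsurj : ∀ h : ι → ℝ, Qt h = 0 → ∃ z : σ → ℝ, P z = h)
    {Φ : (κ → ℝ) → (ι → ℝ)} (hΦQ : ∀ w, Qt (Φ w) = w) (hΦcrit : ∀ (w : κ → ℝ) (h : ι → ℝ), Qt h = 0 → S' (Φ w) h = 0)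
    (w : κ → ℝ) :
    -log (∫ z : σ → ℝ, exp (-S (M w + P z))) = S (Φ w) - log (∫ z : σ → ℝ, exp (-((1 / 2 : ℝ) * H (P z) (P z)))) := by
  rw [fibreIntegral_eq_gaussian Qt M P hquad hQM hQP hPsurj hΦQ hΦcrit w,
    log_mul (exp_pos _).ne' (formIntegral_pos P hfl hm hP hp).ne', log_exp]
  ring

omit [Fintype κ] in
/-- **IDENTICAL INCREMENTS**: for all block fields `w, w′`, `W_int w′ − W_int w = S(Φ w′) − S(Φ w)` — in the Gaussian case the
fluctuation integral contributes NOTHING to the `w`-dependence of the effective action. [folklore] -/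
theorem increment_eq
    (hquad : ∀ φ ψ : ι → ℝ, S ψ = S φ + S' φ (ψ - φ) + (1 / 2 : ℝ) * H (ψ - φ) (ψ - φ))
    (hfl : ∀ h : ι → ℝ, m * ∑ x, h x ^ 2 ≤ H h h) (hm : 0 < m)
    (hQM : ∀ k : κ → ℝ, Qt (M k) = k) (hQP : ∀ z : σ → ℝ, Qt (P z) = 0)
    (hP : ∀ z : σ → ℝ, p * ∑ i, z i ^ 2 ≤ ∑ x, P z x ^ 2) (hp : 0 < p)
    (hPsurj : ∀ h : ι → ℝ, Qt h = 0 → ∃ z : σ → ℝ, P z = h)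
    {Φ : (κ → ℝ) → (ι → ℝ)} (hΦQ : ∀ w, Qt (Φ w) = w) (hΦcrit : ∀ (w : κ → ℝ) (h : ι → ℝ), Qt h = 0 → S' (Φ w) h = 0)
    (w w' : κ → ℝ) :
    -log (∫ z : σ → ℝ, exp (-S (M w' + P z))) - -log (∫ z : σ → ℝ, exp (-S (M w + P z))) = S (Φ w') - S (Φ w) := by
  rw [negLog_fibreIntegral_eq Qt M P hquad hfl hm hQM hQP hP hp hPsurj hΦQ hΦcrit w,
    negLog_fibreIntegral_eq Qt M P hquad hfl hm hQM hQP hP hp hPsurj hΦQ hΦcrit w']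
  ring

/-! ## §3. Toy -/

/-- Toy (§1 `formIntegral_pos` with `H h k = 2·h(⋆)·k(⋆)` on one site, floor `2`, identity chart): the Gaussian fluctuation
integral `∫ e^{−z²} dz` is positive. -/
example : 0 < ∫ z : Unit → ℝ, exp (-((1 / 2 : ℝ) *
    ((2 : ℝ) • (ContinuousLinearMap.mul ℝ ℝ).bilinearComp (ContinuousLinearMap.proj (R := ℝ) (φ := fun _ : Unit => ℝ) ())
      (ContinuousLinearMap.proj (R := ℝ) (φ := fun _ : Unit => ℝ) ()))
      ((ContinuousLinearMap.id ℝ (Unit → ℝ)) z) ((ContinuousLinearMap.id ℝ (Unit → ℝ)) z))) := by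
  refine formIntegral_pos (m := 2) (p := 1) (ContinuousLinearMap.id ℝ (Unit → ℝ)) (fun h => ?_) two_pos (fun z => by simp)
    one_pos
  simp only [Finset.univ_unique, PUnit.default_eq_unit, Finset.sum_singleton, smul_apply,
    ContinuousLinearMap.bilinearComp_apply, ContinuousLinearMap.proj_apply, ContinuousLinearMap.mul_apply', smul_eq_mul]
  nlinarith [sq_nonneg (h ())]

end Summit.QuantumFields.BalabanUV.T4Continuum.NE7b.SupConvexStepGaussianExact

end
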